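import Summits.NavierStokesRegularity.NavierStokesRegularity.Theses.CoriolisHead
import Summits.NavierStokesRegularity.NavierStokesRegularity.Theorems.CoriolisHeadNoCoRotatingCoreNormalForm
import Summits.NavierStokesRegularity.NavierStokesRegularity.Theorems.CoriolisHeadNoCoRotatingCoreUniformGradient
import Literature.Analysis.FluidPDE.TaoEnstrophyLocalisation
import HarnessLib

/-!
# Route CoriolisHead · crux `NoCoRotatingCore` (stmt-NavierStokesRegularity-22676) —
# UNIFORM bounds for ALL derivatives of a bounded rotated profile: `sup ‖DᵏU‖ ≤ Cₖ (sup|U|)^{k+1}/νᵏ`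

Support file (`--supports stmt-NavierStokesRegularity-22676`; theorems only, no definitions, no named
facts).  Sequel of `CoriolisHeadNoCoRotatingCoreUniformGradient` (`k = 1`): the same physical-variables
argument (Navier–Stokes rescaling of a window the ANCIENT solution provides + KNSS 2009 (4.10) on
bounded weak solutions + continuity in time) run for every order `k`.

* `exists_norm_iteratedFDeriv_le_of_ancient_typeI` — for each `k` an absolute `Cₖ` with
  `‖Dᵏu(−1, x)‖ ≤ Cₖ N^{k+1}` for every classical Navier–Stokes solution on `ℝ³ × (−∞, 0)` with
  `‖u(t, x)‖ ≤ N/√(−t)` (the rescaling `v(s, y) = κu(t₀ + κ²s, κy)`, `κ = √τ/N`, has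
  `Dᵏv = κ^{k+1} Dᵏu`, and `κ⁻¹ ≤ 2N`).
* `exists_norm_iteratedFDeriv_le_of_pvProfile` — every smooth divergence-free solution of
  Pineau–Vicol's profile system (1.8a), ANY rotation rate, with `sup |V| ≤ M` has
  `sup ‖DᵏV‖ ≤ Cₖ M^{k+1}`.
* `exists_norm_iteratedFDeriv_le_of_rotatedProfile` — in the crux's variables (any `ν, a > 0`, any
  skew `B`): `sup ‖DᵏU‖ ≤ Cₖ (sup |U|)^{k+1}/νᵏ` (dilation + isometry bookkeeping of the normal form;
  the rate `a` cancels).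

Use.  With bounded `DU`, `D²U` the pressure gradient of a bounded rotated profile grows at most
linearly and the rotating head `Π_B` at most quadratically (exactly the integrability side of the
backup 'stationary-measure' line: `∫ (L f) m = 0` needs `∇f` of polynomial growth); uniform `Cᵏ`
bounds also give local compactness of the class of bounded profiles of amplitude `≤ M`.

HONEST FRAMING.  Regularity bookkeeping for GIVEN profiles; nothing here proves `NoCoRotatingCore`,
`X`, or Navier–Stokes regularity.

References: G. Koch, N. Nadirashvili, G. Seregin, V. Šverák, Acta Math. 203 (2009) =
arXiv:0709.3599, §4 (4.10) [KochNadirashviliSereginSverak2009]; B. Pineau, V. Vicol,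
arXiv:2607.09619 (2026), (1.7)–(1.8) [PineauVicol2026].
-/

noncomputable section

-- the summit and its single sub-problem share the name (CONVENTIONS §1), as in every Theorems file
set_option linter.dupNamespace false

open Set Function Filter MeasureTheory
open scoped ContDiff Laplacian RealInnerProductSpace Topology BigOperators
open Literature.Analysis.FluidPDE Literature.Analysis.FluidPDE.PineauVicol2026

namespace Summit.NavierStokesRegularity.NavierStokesRegularity.Theorems.CoriolisHead

/-! ### Scaling of iterated derivatives under a dilation -/

/-- `‖Dᵏ(b • f(c ·))(x)‖ ≤ |b| |c|ᵏ ‖Dᵏf(cx)‖` for `f ∈ C^∞` (chain rule with the linear map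
`c • id`, whose norm is `≤ |c|`). [folklore] -/
theorem norm_iteratedFDeriv_const_smul_comp_smul_le {F : Type*} [NormedAddCommGroup F]
    [NormedSpace ℝ F] {f : EuclideanSpace ℝ (Fin 3) → F} (hf : ContDiff ℝ ∞ f) (b c : ℝ)
    (k : ℕ) (x : EuclideanSpace ℝ (Fin 3)) :
    ‖iteratedFDeriv ℝ k (fun y => b • f (c • y)) x‖ ≤ |b| * |c| ^ k * ‖iteratedFDeriv ℝ k f (c • x)‖ := by
  set L : EuclideanSpace ℝ (Fin 3) →L[ℝ] EuclideanSpace ℝ (Fin 3) :=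
    c • ContinuousLinearMap.id ℝ (EuclideanSpace ℝ (Fin 3)) with hL
  have hLapply : ∀ y, L y = c • y := fun y => by simp [hL]
  have hfL : ContDiff ℝ ∞ (f ∘ L) := hf.comp L.contDiff
  have e1 : (fun y => b • f (c • y)) = fun y => b • (f ∘ L) y := by
    funext y; simp only [Function.comp_apply, hLapply]
  rw [e1, iteratedFDeriv_const_smul_apply' (hfL.contDiffAt.of_le (by exact_mod_cast le_top)),
    ContinuousLinearMap.iteratedFDeriv_comp_right L hf x (i := k) (by exact_mod_cast le_top), norm_smul,
    Real.norm_eq_abs, hLapply, mul_assoc]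
  refine mul_le_mul_of_nonneg_left ?_ (abs_nonneg _)
  refine (ContinuousMultilinearMap.norm_compContinuousLinearMap_le _ _).trans ?_
  rw [Finset.prod_const, Finset.card_univ, Fintype.card_fin, mul_comm]
  refine mul_le_mul_of_nonneg_right (pow_le_pow_left₀ (norm_nonneg _) ?_ k) (norm_nonneg _)
  calc ‖L‖ ≤ ‖c‖ * ‖ContinuousLinearMap.id ℝ (EuclideanSpace ℝ (Fin 3))‖ := by
        rw [hL]; exact norm_smul_le c (ContinuousLinearMap.id ℝ (EuclideanSpace ℝ (Fin 3)))
    _ ≤ |c| * 1 := by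
        rw [Real.norm_eq_abs]
        exact mul_le_mul_of_nonneg_left ContinuousLinearMap.norm_id_le (abs_nonneg _)
    _ = |c| := mul_one _

/-! ### All derivatives of a Type-I-in-time ancient classical solution -/

/-- **Scale-invariant KNSS bounds of every order for ancient solutions.** For each `k` there is an
absolute `Cₖ ≥ 0` such that every classical Navier–Stokes solution (`ν = 1`, no force) on
`ℝ³ × (−∞, 0)` with `‖u(t, x)‖ ≤ N/√(−t)` for all `t < 0` satisfies `‖Dᵏu(−1, x)‖ ≤ Cₖ N^{k+1}` for all
`x` (KNSS 2009 (4.10) of order `k` on the rescaled window, as in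
`exists_norm_fderiv_le_of_ancient_typeI`). [cite: KochNadirashviliSereginSverak2009, §4 (4.10) (arXiv:0709.3599 p. 8)] -/
theorem exists_norm_iteratedFDeriv_le_of_ancient_typeI (k : ℕ) :
    ∃ C : ℝ, 0 ≤ C ∧ ∀ {u : ℝ → (EuclideanSpace ℝ (Fin 3)) → (EuclideanSpace ℝ (Fin 3))}
      {p : ℝ → (EuclideanSpace ℝ (Fin 3)) → ℝ},
      IsClassicalNSSolutionOn (Iio 0) 1 0 u p → ∀ {N : ℝ},
      (∀ t < (0 : ℝ), ∀ x, ‖u t x‖ ≤ N / Real.sqrt (-t)) →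
      ∀ x, ‖iteratedFDeriv ℝ k (u (-1)) x‖ ≤ C * N ^ (k + 1) := by
  obtain ⟨Cw, Lw, Nw, hwin⟩ := KNSS2009_regularity_boundedWeak_window_holds 1 2 (by norm_num)
  refine ⟨2 ^ (k + 1) * max (Cw k 1) 0 + 1, by positivity, ?_⟩
  intro u p hcl N hN x
  have hN0 : 0 ≤ N := by
    have h := hN (-1) (by norm_num) 0
    rw [neg_neg, Real.sqrt_one, div_one] at h
    exact (norm_nonneg _).trans h
  -- order zero: the Type-I bound itself
  rcases Nat.eq_zero_or_pos k with hk0 | hkpos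
  · subst hk0
    rw [norm_iteratedFDeriv_zero]
    have h := hN (-1) (by norm_num) x
    rw [neg_neg, Real.sqrt_one, div_one] at h
    calc ‖u (-1) x‖ ≤ N := h
      _ = 1 * N ^ (0 + 1) := by ring
      _ ≤ (2 ^ (0 + 1) * max (Cw 0 1) 0 + 1) * N ^ (0 + 1) := by
          gcongr
          have : 0 ≤ 2 ^ (0 + 1) * max (Cw 0 1) 0 := by positivity
          linarith
  have hkne : k ≠ 0 := Nat.pos_iff_ne_zero.1 hkpos
  rcases hN0.eq_or_lt with hN00 | hNpos
  · -- `N = 0`: the solution vanishes at `t = -1`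
    have hu : u (-1) = fun _ => (0 : (EuclideanSpace ℝ (Fin 3))) := by
      funext y
      have h := hN (-1) (by norm_num) y
      rw [← hN00, zero_div] at h
      exact norm_le_zero_iff.1 h
    rw [hu, iteratedFDeriv_fun_zero]
    simp only [Pi.zero_apply, norm_zero]
    positivity
  -- `N > 0`: the window
  set τ : ℝ := (2 * N ^ 2 + 1) / (2 * (N ^ 2 + 1)) with hτ
  have hN2 : 0 < N ^ 2 := by positivity
  have hτpos : 0 < τ := by positivity
  have hτ1 : τ < 1 := by
    rw [hτ, div_lt_one (by positivity)]; linarith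
  have hτhalf : 1 / 2 ≤ τ := by
    rw [hτ, le_div_iff₀ (by positivity)]; linarith
  set κ : ℝ := Real.sqrt τ / N with hκ
  have hκpos : 0 < κ := div_pos (Real.sqrt_pos.2 hτpos) hNpos
  have hκ2 : κ ^ 2 = τ / N ^ 2 := by
    rw [hκ, div_pow, Real.sq_sqrt hτpos.le]
  have hτκ : 1 - τ < κ ^ 2 := by
    rw [hκ2, lt_div_iff₀ hN2, hτ]
    field_simp
    nlinarith
  -- `κ⁻¹ ≤ 2N` (since `√τ ≥ √(1/2) > 1/2`)
  have hκinv : κ⁻¹ ≤ 2 * N := by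
    rw [hκ, inv_div, div_le_iff₀ (Real.sqrt_pos.2 hτpos)]
    have h14 : (1 / 2 : ℝ) ≤ Real.sqrt τ := by
      rw [Real.le_sqrt (by norm_num) hτpos.le]
      linarith
    nlinarith
  set t₀ : ℝ := -τ - 2 * κ ^ 2 with ht₀
  set v : ℝ → (EuclideanSpace ℝ (Fin 3)) → (EuclideanSpace ℝ (Fin 3)) := κ • stPull (κ ^ 2) κ t₀ 0 u with hv
  have hcl' : IsClassicalNSSolutionOn ((fun r => t₀ + κ ^ 2 * r) ⁻¹' Iio 0) 1 0 v
      (κ ^ 2 • stPull (κ ^ 2) κ t₀ 0 p) := hcl.nsRescale_translate_zero hκpos t₀ 0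
  have hwin_t : ∀ s ∈ Ioo (0 : ℝ) 2, t₀ + κ ^ 2 * s < -τ := by
    intro s hs
    rw [ht₀]
    nlinarith [hs.2, sq_nonneg κ, hκpos]
  have hsub : Ioo (0 : ℝ) 2 ⊆ (fun r => t₀ + κ ^ 2 * r) ⁻¹' Iio 0 := fun s hs => by
    simp only [mem_preimage, mem_Iio]
    linarith [hwin_t s hs]
  have hclv : IsClassicalNSSolutionOn (Ioo (0 : ℝ) 2) 1 0 v (κ ^ 2 • stPull (κ ^ 2) κ t₀ 0 p) :=
    hcl'.mono hsub (uniqueDiffOn_Ioo 0 2)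
  have hvb : ∀ s ∈ Ioo (0 : ℝ) 2, ∀ y, ‖v s y‖ ≤ 1 := by
    intro s hs y
    have ht : t₀ + κ ^ 2 * s < 0 := by linarith [hwin_t s hs]
    have hτt : τ ≤ -(t₀ + κ ^ 2 * s) := by linarith [hwin_t s hs]
    have hsq : Real.sqrt τ ≤ Real.sqrt (-(t₀ + κ ^ 2 * s)) := Real.sqrt_le_sqrt hτt
    have hsτ : 0 < Real.sqrt τ := Real.sqrt_pos.2 hτpos
    rw [hv, smul_stPull_slice]
    simp only [zero_add]
    rw [norm_smul, Real.norm_of_nonneg hκpos.le]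
    calc κ * ‖u (t₀ + κ ^ 2 * s) (κ • y)‖
        ≤ κ * (N / Real.sqrt (-(t₀ + κ ^ 2 * s))) :=
          mul_le_mul_of_nonneg_left (hN _ ht _) hκpos.le
      _ ≤ κ * (N / Real.sqrt τ) := by
          gcongr
      _ = 1 := by
          rw [hκ]; field_simp
  have hweak : IsBoundedWeakNSSolutionOn (Ioo (0 : ℝ) 2) isOpen_Ioo 1 v :=
    hclv.isBoundedWeakNSSolutionOn ⟨1, hvb⟩
  obtain ⟨W, b, -, -, -, hae, hWs, -, hWC, -, -⟩ := hwin hweak hvb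
  -- from almost every time to every time of `(1, 2)`, by continuity of `s ↦ Dᵏ(v s)(y)`
  have hws : IsSmoothSpaceTimeOn (Ioo (0 : ℝ) 2) v := hclv.smooth_velocity
  have hSU : UniqueDiffOn ℝ (Ioo (0 : ℝ) 2) := uniqueDiffOn_Ioo 0 2
  have hsub1 : Ioo (1 : ℝ) 2 ⊆ Ioo 0 2 := Ioo_subset_Ioo_left zero_le_one
  have hvx : ∀ s ∈ Ioo (0 : ℝ) 2, Continuous (v s) := fun s hs =>
    (hws.contDiff_slice hs).continuous
  have hgood : ∀ᵐ s ∂((volume : Measure ℝ).restrict (Ioo (0 : ℝ) 2)),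
      s ∈ Ioo (0 : ℝ) 2 ∧ ∀ y, v s y = W s y + b s := by
    filter_upwards [hae, ae_restrict_mem measurableSet_Ioo] with s hs hsm
    refine ⟨hsm, fun y => ?_⟩
    have hc2 : Continuous fun y => W s y + b s := (hWs s hsm).continuous.add continuous_const
    exact congr_fun ((Continuous.ae_eq_iff_eq volume (hvx s hsm) hc2).1 hs) y
  have hgood1 : ∀ᵐ s ∂((volume : Measure ℝ).restrict (Ioo (1 : ℝ) 2)),
      s ∈ Ioo (0 : ℝ) 2 ∧ ∀ y, v s y = W s y + b s :=
    ae_restrict_of_ae_restrict_of_subset hsub1 hgood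
  have hsp : ∀ s₀ ∈ Ioo (1 : ℝ) 2, ∀ y, ‖iteratedFDeriv ℝ k (v s₀) y‖ ≤ Cw k 1 := by
    intro s₀ hs₀ y
    have hcont : ContinuousOn (fun s => ‖iteratedFDeriv ℝ k (v s) y‖) (Ioo 1 2) := by
      have h1 := ((hws.iteratedFDeriv_slice hSU k).continuousOn).comp
        (continuousOn_id.prodMk continuousOn_const) (fun s hs => mk_mem_prod hs (mem_univ y))
      exact (h1.mono hsub1).norm
    refine ChaeWolf.le_of_ae_le_of_continuousOn hcont ?_ s₀ hs₀
    filter_upwards [hgood1, ae_restrict_mem measurableSet_Ioo] with s hs hs1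
    have heq : v s = fun y => W s y + b s := funext hs.2
    have hWk : ContDiffAt ℝ k (W s) y := ((hWs s hs.1).of_le (by exact_mod_cast le_top)).contDiffAt
    rw [heq, fun_iteratedFDeriv_add_apply hWk contDiffAt_const, iteratedFDeriv_const_of_ne hkne]
    simpa using hWC 1 one_pos k s hs1 y
  -- the time `s₁ ∈ (1, 2)` above `t = -1`
  set s₁ : ℝ := (-1 - t₀) / κ ^ 2 with hs₁
  have hκ20 : κ ^ 2 ≠ 0 := by positivity
  have hts₁ : t₀ + κ ^ 2 * s₁ = -1 := by
    rw [hs₁]; field_simp; ring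
  have hs₁mem : s₁ ∈ Ioo (1 : ℝ) 2 := by
    rw [hs₁, ht₀, mem_Ioo, lt_div_iff₀ (by positivity), div_lt_iff₀ (by positivity)]
    constructor <;> nlinarith
  have hvs : v s₁ = fun y => κ • u (-1) (κ • y) := by
    funext y
    rw [hv, smul_stPull_slice]
    simp only [zero_add, hts₁]
  -- undo the scaling: `u(-1) = κ⁻¹ • v(s₁)(κ⁻¹ ·)`
  have hus : u (-1) = fun x => κ⁻¹ • v s₁ (κ⁻¹ • x) := by
    funext x
    rw [hvs]
    simp only [smul_smul, inv_mul_cancel₀ hκpos.ne', one_smul, mul_inv_cancel₀ hκpos.ne']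
  have hvsm : ContDiff ℝ ∞ (v s₁) := hws.contDiff_slice (hsub1 hs₁mem)
  have key := norm_iteratedFDeriv_const_smul_comp_smul_le hvsm κ⁻¹ κ⁻¹ k x
  rw [← hus, abs_of_pos (inv_pos.2 hκpos)] at key
  have hk1 : κ⁻¹ * κ⁻¹ ^ k = κ⁻¹ ^ (k + 1) := by ring
  calc ‖iteratedFDeriv ℝ k (u (-1)) x‖
      ≤ κ⁻¹ * κ⁻¹ ^ k * ‖iteratedFDeriv ℝ k (v s₁) (κ⁻¹ • x)‖ := key
    _ ≤ κ⁻¹ ^ (k + 1) * max (Cw k 1) 0 := by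
        rw [hk1]
        exact mul_le_mul_of_nonneg_left ((hsp s₁ hs₁mem _).trans (le_max_left _ _))
          (by positivity)
    _ ≤ (2 * N) ^ (k + 1) * max (Cw k 1) 0 := by
        gcongr
    _ = 2 ^ (k + 1) * max (Cw k 1) 0 * N ^ (k + 1) := by ring
    _ ≤ (2 ^ (k + 1) * max (Cw k 1) 0 + 1) * N ^ (k + 1) := by
        have : 0 ≤ N ^ (k + 1) := by positivity
        nlinarith

/-! ### All derivatives of a Pineau–Vicol profile -/

/-- **Uniform bounds of every order for rotated self-similar profiles (any rotation rate).** For each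
`k` there is an absolute `Cₖ ≥ 0` such that every smooth divergence-free solution `(V, Q)` of
Pineau–Vicol's profile system `α(JV − DV[Jy]) + ½V + ½DV[y] − ΔV + DV[V] + ∇Q = 0` with `sup |V| ≤ M`
satisfies `‖DᵏV(y)‖ ≤ Cₖ M^{k+1}` everywhere (`u = pvAnsatz α V` is a classical solution on `(−∞, 0)`
with `‖u(t,x)‖ ≤ M/√(−t)` and `u(−1, ·) = V`). [cite: PineauVicol2026, (1.7)–(1.8a) and Remark 1.2 (arXiv:2607.09619 p. 3)] -/
theorem exists_norm_iteratedFDeriv_le_of_pvProfile (k : ℕ) :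
    ∃ C : ℝ, 0 ≤ C ∧ ∀ {α : ℝ} {V : (EuclideanSpace ℝ (Fin 3)) → (EuclideanSpace ℝ (Fin 3))}
      {Q : (EuclideanSpace ℝ (Fin 3)) → ℝ},
      ContDiff ℝ ∞ V → ContDiff ℝ ∞ Q → VectorCalculus.IsDivFree V →
      (∀ y, α • (rotGen (V y) - fderiv ℝ V y (rotGen y)) + (1 / 2 : ℝ) • V y
        + (1 / 2 : ℝ) • fderiv ℝ V y y - (Δ V) y + fderiv ℝ V y (V y) + gradient Q y = 0) →
      ∀ {M : ℝ}, (∀ y, ‖V y‖ ≤ M) → ∀ y, ‖iteratedFDeriv ℝ k V y‖ ≤ C * M ^ (k + 1) := by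
  obtain ⟨C, hC, h⟩ := exists_norm_iteratedFDeriv_le_of_ancient_typeI k
  refine ⟨C, hC, ?_⟩
  intro α V Q hV hQ hdiv heq M hM y
  have hNS := isClassicalNSSolutionOn_pvAnsatz_of_profile (α := α) hV hQ hdiv heq
  have hbd : ∀ t < (0 : ℝ), ∀ x, ‖pvAnsatz α (fun y _ => V y) t x‖ ≤ M / Real.sqrt (-t) := by
    intro t ht x
    rw [norm_pvAnsatz, div_eq_inv_mul]
    exact mul_le_mul_of_nonneg_left (hM _) (inv_nonneg.2 (Real.sqrt_nonneg _))
  have key := h hNS hbd y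
  have e1 : pvAnsatz α (fun y _ => V y) (-1) = V := funext fun x => pvAnsatz_neg_one α _ x
  rwa [e1] at key

/-! ### All derivatives in the crux's variables -/

/-- **Uniform bounds of every order for bounded rotated Leray profiles (any `ν, a > 0`, any skew
`B`).** For each `k` there is an absolute `Cₖ ≥ 0` such that every smooth divergence-free solution
`(U, P)` of `−νΔU + aU + a DU[y] + (BU − DU[By]) + DU[U] + ∇P = 0` with `sup |U| ≤ M` satisfies
`‖DᵏU(y)‖ ≤ Cₖ M^{k+1}/νᵏ` everywhere: normal form `U(y) = (ν/c) L⁻¹V(L(y/c))`, `c = √(ν/(2a))`,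
`sup|V| ≤ Mc/ν`, so `‖DᵏU‖ ≤ (ν/c^{k+1}) Cₖ (Mc/ν)^{k+1} = Cₖ M^{k+1}/νᵏ`.
[cite: KochNadirashviliSereginSverak2009, §4 (4.10) (arXiv:0709.3599 p. 8)] -/
theorem exists_norm_iteratedFDeriv_le_of_rotatedProfile (k : ℕ) :
    ∃ C : ℝ, 0 ≤ C ∧ ∀ (ν a : ℝ), 0 < ν → 0 < a →
      ∀ (B : EuclideanSpace ℝ (Fin 3) →L[ℝ] EuclideanSpace ℝ (Fin 3))
        (U : EuclideanSpace ℝ (Fin 3) → EuclideanSpace ℝ (Fin 3)) (P : EuclideanSpace ℝ (Fin 3) → ℝ),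
        ContDiff ℝ ∞ U → ContDiff ℝ 1 P → (∀ x, ⟪B x, x⟫ = 0) → VectorCalculus.IsDivFree U →
        (∀ y, -(ν • (Δ U) y) + a • U y + a • fderiv ℝ U y y + (B (U y) - fderiv ℝ U y (B y))
          + convect U U y + gradient P y = 0) →
        ∀ {M : ℝ}, (∀ y, ‖U y‖ ≤ M) → ∀ y, ‖iteratedFDeriv ℝ k U y‖ ≤ C * M ^ (k + 1) / ν ^ k := by
  obtain ⟨C, hC, h⟩ := exists_norm_iteratedFDeriv_le_of_pvProfile k
  refine ⟨C, hC, ?_⟩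
  intro ν a hν ha B U P hU hP hB hdiv heq M hM y
  obtain ⟨c, hc0, hk2, hW, hR, hB', hdivW, heqW, -⟩ :=
    rotatedProfileSystem_normalise hν ha hU hP hB hdiv heq
  obtain ⟨L, α, hV, hQ, hdivV, heqV, hnormV, -⟩ :=
    rotatedProfileSystem_axisNormalForm hW hR hB' hdivW heqW
  -- names for the normal forms
  set W : EuclideanSpace ℝ (Fin 3) → EuclideanSpace ℝ (Fin 3) := fun w => (c / ν) • U (c • w) with hWdef
  set V : EuclideanSpace ℝ (Fin 3) → EuclideanSpace ℝ (Fin 3) := fun y => L (W (L.symm y)) with hVdef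
  have hkpos : 0 < c / ν := div_pos hc0 hν
  -- amplitude of the Pineau–Vicol profile
  have hVb : ∀ z, ‖V z‖ ≤ M * (c / ν) := fun z => by
    show ‖L ((c / ν) • U (c • L.symm z))‖ ≤ M * (c / ν)
    rw [hnormV z, norm_smul, Real.norm_of_nonneg hkpos.le, mul_comm]
    exact mul_le_mul_of_nonneg_right (hM _) hkpos.le
  have hDV : ∀ z, ‖iteratedFDeriv ℝ k V z‖ ≤ C * (M * (c / ν)) ^ (k + 1) := h hV hQ hdivV heqV hVb
  -- `U = (ν/c) • W(c⁻¹ ·)` and `W = L⁻¹ ∘ V ∘ L`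
  have hUW : U = fun x => (ν / c) • W (c⁻¹ • x) := by
    funext x
    show U x = (ν / c) • ((c / ν) • U (c • (c⁻¹ • x)))
    rw [smul_smul, smul_smul, mul_inv_cancel₀ hc0.ne', one_smul,
      show ν / c * (c / ν) = 1 by field_simp, one_smul]
  have hWV : W = ⇑L.symm ∘ V ∘ ⇑L := by
    funext x
    simp only [hVdef, Function.comp_apply, LinearIsometryEquiv.symm_apply_apply]
  have hW' : ContDiff ℝ ∞ W := hW
  -- the dilation
  have h1 : ‖iteratedFDeriv ℝ k U y‖ ≤ |ν / c| * |c⁻¹| ^ k * ‖iteratedFDeriv ℝ k W (c⁻¹ • y)‖ := by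
    rw [hUW]
    exact norm_iteratedFDeriv_const_smul_comp_smul_le hW' (ν / c) c⁻¹ k y
  -- the isometries
  have h2 : ‖iteratedFDeriv ℝ k W (c⁻¹ • y)‖ = ‖iteratedFDeriv ℝ k V (L (c⁻¹ • y))‖ := by
    rw [hWV, ← Function.comp_assoc, LinearIsometryEquiv.norm_iteratedFDeriv_comp_right,
      LinearIsometryEquiv.norm_iteratedFDeriv_comp_left]
  rw [abs_of_pos (div_pos hν hc0), abs_of_pos (inv_pos.2 hc0), h2] at h1
  calc ‖iteratedFDeriv ℝ k U y‖
      ≤ ν / c * c⁻¹ ^ k * ‖iteratedFDeriv ℝ k V (L (c⁻¹ • y))‖ := h1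
    _ ≤ ν / c * c⁻¹ ^ k * (C * (M * (c / ν)) ^ (k + 1)) :=
        mul_le_mul_of_nonneg_left (hDV _) (by positivity)
    _ = C * M ^ (k + 1) / ν ^ k := by
        rw [mul_pow, div_pow, inv_pow]
        field_simp
        ring

end Summit.NavierStokesRegularity.NavierStokesRegularity.Theorems.CoriolisHead

end
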